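import Summits.Parity.BatemanHorn.Theses.AlmostPrimeZeros
import Summits.Parity.BatemanHorn.Theorems.DiscMajorantLog.Negative.FalseWithoutPairwise
import Summits.Parity.BatemanHorn.Theorems.DiscMajorantLog.Negative.LoadBearingClauses
import Summits.Parity.BatemanHorn.Theorems.DiscMajorantLog.Negative.StrengtheningsRefuted
import Summits.Parity.BatemanHorn.Theorems.DiscMajorantLog.Negative.RightHalfLoadBearing
import Summits.Parity.BatemanHorn.Theorems.AlmostPrimeZerosDiscMajorantLogLeftHalfTwinViolation
import Summits.Parity.BatemanHorn.Theorems.AlmostPrimeZerosSystemZeroRepulsionReduction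
import Summits.Parity.BatemanHorn.Theorems.AlmostPrimeZerosSystemZeroRepulsionNearZoneParityContent

/-!
# Disproof of `DiscMajorantLog` (stmt-Parity-17114) — standing disprover's work file (cdisprove, cycle 1)

Crux (route `AlmostPrimeZeros`, rank 8, near leaf of `SystemZeroRepulsion`):

  `∀ (k,f) BH, ∃ A C x₀, ∀ x ≥ x₀, ∀ z, ‖z − 1‖ ≤ 3 log log x →
     ‖S_x(z)‖ = ‖Σ_{n≤x} z^{s_f(n)}‖ ≤ A·x·(log x)^{k(Re z − 1)}·exp(C‖z−1‖ log(‖z−1‖+2))`,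

`s_f(n) = Σ_i Σ_{p^v ∥ f_i(n)} min(v,2)` (`f_i(n) ≤ 0 ↦ 0`), `L := log log x`.

## FINDINGS (index; everything in §1–§3 is sorry-free, §1–§2 LANDED under `Theorems/DiscMajorantLog/Negative/`)

* **Verdict: NO KILL (cycle 1).**  The statement is a one-sided LSD-quality majorant on a growing disc.
  Its left half-disc (`Re z < 1`, `|z| ≥` about `1`) is tilted Chowla / Halász-type cancellation ALONG `f`
  (open for every system outside `k ≤ 1, deg ≤ 1`; a disproof there = a disproof of Chowla along `f`);
  its right half-disc and real axis are anatomy (exponential moments / almost-prime upper bounds,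
  heuristically true, sieve-provable in principle).  The LSD heuristic `S_x(z) ≈ x λ_f(z)(D log x)^{k(z−1)}Γ(z)^{−k}`
  fits the budget at EVERY point of the disc (§4), so no zone offers a cheap contradiction; numerics
  cannot bite outside `‖z−1‖ ≤ 2` (§4).  See §4 for the zone map and what was tried.
* §1 LOAD-BEARING CLAUSES — all four clauses of `IsBatemanHornSystem` are load-bearing (any proof must use
  each): `pairwise_not_associated` (p136416, `(X,X)`), `irreducible` (p140268, `X²`, even among
  non-constant members), `leadingCoeff_pos` (p140268, `−X`), `hasNoFixedPrimeDivisor` (p140268, `C 2` —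
  through constants only; for non-constant systems with a fixed prime divisor, e.g. `(X, X+1)`, the
  majorant is plausibly TRUE: local factor `E₂(z) = (z+z²)/2`, `E₂(1) = 1`).  Mechanism in all four:
  the PARITY of the statistic collapses (`S_x(−1) = ±(x+1)`), killed by the `z = −1` budget `o(x)`.
* §2 REFUTED STRENGTHENINGS / VARIANTS / APPROACHES (p140363): constants uniform in `f` (false on
  `(X + c)` at `z = 2`); the uncapped statistic `Ω_f` (false for `(X)` at `z = 3`, `n = 2^j`: the cap is
  load-bearing); the triangle inequality (`Σ ‖z‖^{s_f(n)}` never fits the budget, any `f`, `k ≥ 1`).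
* §3 WHAT THE CRUX CONTAINS, pointwise (proved here): `fixedPoint_of_discMajorantLog` (every fixed `z₀`:
  `‖S_x(z₀)‖ ≤ A' x (log x)^{k(Re z₀ − 1)}` eventually — Halász decay `(log x)^{−k(1−cos θ)}` on the unit
  circle, tilted Chowla saving `(log x)^{−k(1+t)}` at `−t`), `liouvilleSaving_of_discMajorantLog`
  (`z₀ = −1`, composition of p96203 + p96296), `one_lt_A` (tightness at `z = 1`: `A > 1`).
* §5 NEAR-MISS (the only sorry): the `log` in the budget is necessary —
  `not_discMajorantLog_linearBudget` (budget `e^{C‖z−1‖}`) should be FALSE for `f = (X)` at `z = −t`,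
  `t` a large half-integer (`|1/Γ(−t)| = Γ(t+1)/π`).  PROVED here: the Euler-product half
  (`one_le_capFactor_neg`: every capped factor at `−t` is `≥ 1`, so `F^cap(−t) ≥ 1`).  MISSING: only the
  capped analogue of `SatheSelberg.omegaB_hypothesis`, after which the tree's PROVED Selberg–Delange theorem
  `MontgomeryVaughan2007_thm_7_18_holds` gives the two-sided asymptotic (recipe in §5).  The `log` factor
  is forced by the LEFT half only; on the right half the budget is slack (§6.4).
* §6 LINE `Sketch` (lead prover-line-stmt-Parity-17114-0; the `Re z = 0` cut `stub_right ∧ stub_left ⟹ crux`,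
  composition `DiscMajorantLog_of` kernel-checked and LOSSLESS — each half is implied by the crux, so neither
  half-disc stub is refutable short of refuting the crux).  Landed for the line: on the RIGHT half
  (`0 ≤ Re z`) ALL FOUR clauses stay load-bearing, by PARITY-FREE witnesses at real points —
  `leadingCoeff_pos` (`−X`, `t = 1/2`), `hasNoFixedPrimeDivisor` (`C 2`, `t = 1/2`), `pairwise` (`(X,X)`,
  `t = 1/4`, prime number theorem) in `Negative/RightHalfLoadBearing.lean` (p141187), `irreducible` (`X²`,
  `t = 2`, the tree's PROVED Selberg–Delange theorem at `z = 4`) in `Negative/RightHalfIrreducible.lean`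
  (p141682) — and the triangle inequality fails there too (`z = i`, p141187).  The LEAD has landed the line's
  auxiliary stubs (`…DiscMajorantLogLargePrimeSwitch/FinZero/LeftHalfTwinViolation/RightHalfTwinOfDisc.lean`)
  and the fixed-disc calibration `f = X` (`…FixedDiscX.lean`); this seat's independent proof of the twin
  stub (p141681) bounced as a duplicate.  What remains of the line is exactly the two half-disc stubs.
* Targets (lead's stuck stubs): none yet (`payload.stuck_stubs = []`).

Prior seats' evidence used: refuter-rattack CruxAttack.lean / disc_check.txt (numerics `x ≤ 10⁶`, fitted
`C ≈ 1.5` for `X`, `3.2` for `(X,X+2)`, argmax on the negative axis), ROUTE-REVIEW.md, STRATEGY-CENSUS.md §1.3–1.4.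
-/

noncomputable section

namespace Summit.Parity.BatemanHorn.Cruxes.DiscMajorantLog.Disproof

open Polynomial Filter
open Literature.NumberTheory.Sieve
open Summit.Parity.BatemanHorn.Theses.AlmostPrimeZeros (DiscMajorantLog)
open Summit.Parity.BatemanHorn.Theorems.DiscMajorantLog.Negative
open Summit.Parity.BatemanHorn.Cruxes.SystemZeroRepulsion.Reduction
  (discMajorant_of_discMajorantLog liouvilleSaving_of_discMajorant)

/-! ## §0 Vocabulary: the body of the crux for a general exponent sequence -/

/-- The capped statistic of the system along `n`. -/
def stat {k : ℕ} (f : Fin k → ℤ[X]) (n : ℕ) : ℕ :=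
  ∑ i, (((f i).eval (n : ℤ)).toNat.factorization.sum fun _ v => min v 2)

/-- The body of `DiscMajorantLog` for parameter `k` and exponent sequence `e`. -/
def Body (k : ℕ) (e : ℕ → ℕ) : Prop :=
  ∃ A C : ℝ, ∃ x₀ : ℕ, ∀ x : ℕ, x₀ ≤ x → ∀ z : ℂ, ‖z - 1‖ ≤ 3 * Real.log (Real.log (x : ℝ)) →
    ‖(∑ n ∈ Finset.range (x + 1), (z : ℂ) ^ (e n))‖ ≤
      A * (x : ℝ) * (Real.log (x : ℝ)) ^ ((k : ℝ) * ((z : ℂ).re - 1)) *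
        Real.exp (C * ‖(z : ℂ) - 1‖ * Real.log (‖(z : ℂ) - 1‖ + 2))

/-- The crux, definitionally. -/
theorem discMajorantLog_iff :
    DiscMajorantLog ↔ ∀ (k : ℕ) (f : Fin k → ℤ[X]), IsBatemanHornSystem f → Body k (stat f) := Iff.rfl

/-! ## §1 Load-bearing analysis: every clause of `IsBatemanHornSystem` is used by any proof -/

/-- The crux with `pairwise_not_associated` dropped. -/
def WithoutPairwise : Prop :=
  ∀ (k : ℕ) (f : Fin k → ℤ[X]), (∀ i, Irreducible (f i)) → (∀ i, 0 < (f i).leadingCoeff) →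
    HasNoFixedPrimeDivisor f → Body k (stat f)

/-- The crux with `irreducible` dropped but every member still NON-CONSTANT. -/
def WithoutIrreducible : Prop :=
  ∀ (k : ℕ) (f : Fin k → ℤ[X]), (∀ i, 0 < (f i).natDegree) → (∀ i, 0 < (f i).leadingCoeff) →
    (Pairwise fun i j => ¬Associated (f i) (f j)) → HasNoFixedPrimeDivisor f → Body k (stat f)

/-- The crux with `leadingCoeff_pos` dropped (members still non-constant). -/
def WithoutLeadingCoeffPos : Prop :=
  ∀ (k : ℕ) (f : Fin k → ℤ[X]), (∀ i, 0 < (f i).natDegree) → (∀ i, Irreducible (f i)) →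
    (Pairwise fun i j => ¬Associated (f i) (f j)) → HasNoFixedPrimeDivisor f → Body k (stat f)

/-- The crux with `hasNoFixedPrimeDivisor` dropped. -/
def WithoutNoFixedPrimeDivisor : Prop :=
  ∀ (k : ℕ) (f : Fin k → ℤ[X]), (∀ i, Irreducible (f i)) → (∀ i, 0 < (f i).leadingCoeff) →
    (Pairwise fun i j => ¬Associated (f i) (f j)) → Body k (stat f)

/-- `pairwise_not_associated` is load-bearing (p136416; witness `(X, X)`, `z = −1`). -/
theorem discMajorantLog_false_without_pairwise : ¬ WithoutPairwise :=
  discMajorantLog_false_without_pairwise_not_associated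

/-- `irreducible` is load-bearing even among non-constant members (p140268; witness `X²`: statistic `2ω(n)`). -/
theorem discMajorantLog_false_without_irreducible' : ¬ WithoutIrreducible :=
  discMajorantLog_false_without_irreducible

/-- `leadingCoeff_pos` is load-bearing (p140268; witness `−X`: values `≤ 0` are discarded, statistic `0`). -/
theorem discMajorantLog_false_without_leadingCoeff_pos' : ¬ WithoutLeadingCoeffPos :=
  discMajorantLog_false_without_leadingCoeff_pos

/-- `hasNoFixedPrimeDivisor` is load-bearing — via constants (p140268; witness `C 2`: statistic `1`).
HYPOTHESIS-MUTATION REMARK: for NON-CONSTANT systems with a fixed prime divisor (`(X, X+1)`,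
`X² + X + 2`) no violation is visible even heuristically (polynomial local factor with `E_p(1) = 1`); the
clause matters for the route's extraction step, not visibly for this leaf. -/
theorem discMajorantLog_false_without_hasNoFixedPrimeDivisor' : ¬ WithoutNoFixedPrimeDivisor :=
  discMajorantLog_false_without_hasNoFixedPrimeDivisor

/-! ## §2 Refuted strengthenings / variants / approaches (p140363) -/

/-- Constants uniform in the system: FALSE (degree-one translates `X + c`, `z = 2`). -/
theorem not_uniform :
    ¬ ∃ A C : ℝ, ∃ x₀ : ℕ, ∀ (k : ℕ) (f : Fin k → ℤ[X]), IsBatemanHornSystem f →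
      ∀ x : ℕ, x₀ ≤ x → ∀ z : ℂ, ‖z - 1‖ ≤ 3 * Real.log (Real.log (x : ℝ)) →
        ‖(∑ n ∈ Finset.range (x + 1), (z : ℂ) ^ (stat f n))‖ ≤
          A * (x : ℝ) * (Real.log (x : ℝ)) ^ ((k : ℝ) * ((z : ℂ).re - 1)) *
            Real.exp (C * ‖(z : ℂ) - 1‖ * Real.log (‖(z : ℂ) - 1‖ + 2)) :=
  not_discMajorantLog_uniform

/-- The cap `min(v,2)` is load-bearing: the `Ω`-variant is FALSE (`f = (X)`, `z = 3`, `n = 2^j`). -/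
theorem not_uncapped :
    ¬ ∀ (k : ℕ) (f : Fin k → ℤ[X]), IsBatemanHornSystem f →
      Body k (fun n => ∑ i, (((f i).eval (n : ℤ)).toNat.factorization.sum fun _ v => v)) :=
  not_discMajorantLog_uncapped

/-- No proof through the triangle inequality, for any system with `k ≥ 1`. -/
theorem not_abs {k : ℕ} (hk : 1 ≤ k) (f : Fin k → ℤ[X]) :
    ¬ ∃ A C : ℝ, ∃ x₀ : ℕ, ∀ x : ℕ, x₀ ≤ x → ∀ z : ℂ, ‖z - 1‖ ≤ 3 * Real.log (Real.log (x : ℝ)) →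
      (∑ n ∈ Finset.range (x + 1), ‖z‖ ^ (stat f n)) ≤
        A * (x : ℝ) * (Real.log (x : ℝ)) ^ ((k : ℝ) * ((z : ℂ).re - 1)) *
          Real.exp (C * ‖(z : ℂ) - 1‖ * Real.log (‖(z : ℂ) - 1‖ + 2)) :=
  not_discMajorantLog_abs hk f

/-! ## §3 What the crux contains, pointwise (positive specialisations; tightness at the centre) -/

/-- **Pointwise content.**  `DiscMajorantLog` gives, at every FIXED `z₀ ∈ ℂ` (in the disc for all large `x`),
`‖S_x(z₀)‖ ≤ A' x (log x)^{k(Re z₀ − 1)}` eventually, `A' = A e^{C‖z₀−1‖log(‖z₀−1‖+2)}`.  Zone by zone: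
`z₀ = e^{iθ}` — Halász-type decay `(log x)^{−k(1−cos θ)}` of `Σ_n e^{iθ s_f(n)}` (the right half-disc part
is parity-blind in Selberg's sense, open beyond `k ≤ 1` linear); `z₀ = −t ≤ 0` — tilted Chowla along `f`
with saving `(log x)^{k(1+t)}` over `x` (`t = 1`: `liouvilleSaving_of_discMajorantLog`); `0 < z₀ < 1` —
almost-prime upper bounds of Brun–Titchmarsh order; `z₀ > 1` — sharp exponential moments. [folklore] -/
theorem fixedPoint_of_discMajorantLog (h : DiscMajorantLog) {k : ℕ} {f : Fin k → ℤ[X]}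
    (hf : IsBatemanHornSystem f) (z₀ : ℂ) :
    ∃ A' : ℝ, ∃ x₁ : ℕ, ∀ x : ℕ, x₁ ≤ x →
      ‖∑ n ∈ Finset.range (x + 1), z₀ ^ (stat f n)‖ ≤
        A' * (x : ℝ) * (Real.log (x : ℝ)) ^ ((k : ℝ) * (z₀.re - 1)) := by
  obtain ⟨A, C, x₀, hb⟩ := h k f hf
  have ht : Tendsto (fun x : ℕ => 3 * Real.log (Real.log (x : ℝ))) atTop atTop :=
    (Real.tendsto_log_atTop.comp (Real.tendsto_log_atTop.comp tendsto_natCast_atTop_atTop)).const_mul_atTop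
      (by norm_num)
  have hev : ∀ᶠ x : ℕ in atTop, ‖z₀ - 1‖ ≤ 3 * Real.log (Real.log (x : ℝ)) := ht.eventually_ge_atTop _
  obtain ⟨x₁, hx₁⟩ := (hev.and (eventually_ge_atTop x₀)).exists_forall_of_atTop
  refine ⟨A * Real.exp (C * ‖z₀ - 1‖ * Real.log (‖z₀ - 1‖ + 2)), x₁, fun x hx => ?_⟩
  obtain ⟨hz, hxx₀⟩ := hx₁ x hx
  calc ‖∑ n ∈ Finset.range (x + 1), z₀ ^ (stat f n)‖
      ≤ A * (x : ℝ) * (Real.log (x : ℝ)) ^ ((k : ℝ) * (z₀.re - 1)) *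
          Real.exp (C * ‖z₀ - 1‖ * Real.log (‖z₀ - 1‖ + 2)) := hb x hxx₀ z₀ hz
    _ = _ := by ring

/-- **Parity content at `z = −1`** (composition of the landed p96203 `discMajorant_of_discMajorantLog` and
p96296 `liouvilleSaving_of_discMajorant`): the crux implies, for every Bateman–Horn system,
`‖Σ_{n≤x} (−1)^{s_f(n)}‖ ≤ C (x+1)/(log x)^{2k}` for all `x ≥ 2` — Liouville/Chowla cancellation along `f`
with a `(log x)^{2k}` saving; open even as `o(x)` for irreducible `deg ≥ 2` and as a power saving for
`k ≥ 2` linear. [folklore] -/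
theorem liouvilleSaving_of_discMajorantLog (h : DiscMajorantLog) :
    ∀ (k : ℕ) (f : Fin k → ℤ[X]), IsBatemanHornSystem f →
      ∃ C : ℝ, ∀ x : ℕ, 2 ≤ x →
        ‖∑ n ∈ Finset.range (x + 1), (-1 : ℂ) ^ (stat f n)‖ ≤ C * ((x : ℝ) + 1) / (Real.log (x : ℝ)) ^ (2 * k) :=
  liouvilleSaving_of_discMajorant (discMajorant_of_discMajorantLog h)

/-- **Tightness at the centre.**  Any admissible constant `A` exceeds `1`: at `z = 1` the body reads
`x + 1 ≤ A x`. (So the majorant is attained, up to the constant, at the centre of the disc, for every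
system and every `x`; the harmonic factor and the budget are both `1` there.) [folklore] -/
theorem one_lt_A {k : ℕ} {e : ℕ → ℕ} {A C : ℝ} {x₀ : ℕ}
    (hb : ∀ x : ℕ, x₀ ≤ x → ∀ z : ℂ, ‖z - 1‖ ≤ 3 * Real.log (Real.log (x : ℝ)) →
      ‖(∑ n ∈ Finset.range (x + 1), (z : ℂ) ^ (e n))‖ ≤
        A * (x : ℝ) * (Real.log (x : ℝ)) ^ ((k : ℝ) * ((z : ℂ).re - 1)) *
          Real.exp (C * ‖(z : ℂ) - 1‖ * Real.log (‖(z : ℂ) - 1‖ + 2))) :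
    1 < A := by
  set x : ℕ := max x₀ 16 with hxdef
  have hx₀ : x₀ ≤ x := le_max_left _ _
  have hx16 : (16 : ℝ) ≤ x := by exact_mod_cast le_max_right x₀ 16
  obtain ⟨h23, -⟩ := two_le_three_loglog_of_sixteen_le hx16
  have hz : ‖(1 : ℂ) - 1‖ ≤ 3 * Real.log (Real.log (x : ℝ)) := by simp; linarith
  have hmain := hb x hx₀ 1 hz
  have hsum : ‖∑ n ∈ Finset.range (x + 1), (1 : ℂ) ^ (e n)‖ = (x : ℝ) + 1 := by
    simp only [one_pow]; exact norm_sum_range_const_one x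
  rw [hsum] at hmain
  simp only [sub_self, norm_zero, Complex.one_re, mul_zero, Real.rpow_zero, mul_one, zero_mul,
    Real.exp_zero] at hmain
  have hxpos : (0 : ℝ) < x := by linarith
  by_contra hA
  push Not at hA
  nlinarith

/-! ## §5 Near-miss (sorry; the only one in this file)

The `log(‖z−1‖+2)` factor in the budget is the `Γ(z)^{−k}` growth `e^{k|z| log|z|}` of the LSD heuristic.
Dropping it should make the statement FALSE already for `f = (X)`: at `z = −t`, `t = m + 1/2` a large
half-integer, the two-sided LSD law (Tenenbaum III, II.5 Thm 5.2 for the TW-class weight `z^{s(n)}`, any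
fixed `z`) gives `‖S_x(−t)‖ ~ x (log x)^{−t−1} |λ(−t)/Γ(−t)|` with
`|1/Γ(−t)| = Γ(t+1)/π` and `log|λ(−t)| = (t+1) log log t + O(t)` (the primes `p ≤ t` contribute
`2 log(t/p) + (t+1)/p + O(1)` each), i.e. `|λ(−t)/Γ(−t)| = e^{t log t + t log log t + O(t)} ≫ e^{C(t+1)}`.
OBSTRUCTION, sharpened (session 3): (i) the Euler-product lower bound is FREE for the capped statistic —
termwise `(1 − t/p + t²/(p(p−1)))(1 − 1/p)^{−t} ≥ (1 − u + u²)e^{u} ≥ 1` (`u = t/p`; `h(u) = log(1−u+u²) + u`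
has `h(0) = 0`, `h' = (u+u²)/(1−u+u²) ≥ 0`), so `F^cap(1, −t) ≥ 1` for every `t ≥ 0`; (ii) the two-sided
asymptotic IS in reach: the tree PROVES the Selberg–Delange theorem `MontgomeryVaughan2007_thm_7_18_holds`
(MV Thm 7.18, every `R ≥ 1`, error `C_R x (log x)^{Re z−2}`), and what is missing is only the capped
analogue of `SatheSelberg.omegaB_hypothesis` (the coefficient hypothesis for `b_z` on powerful numbers,
≈ 300 lines mirroring `SatheSelbergFromSelbergDelange.lean`; the capped Euler product itself is in
`SelbergDelangeCappedEulerProduct.lean`).  With it: at `t = m + 1/2`, `|1/Γ(−t)| = Γ(t+1)/π`, and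
`Γ(t+1)/π > A e^{C(t+1)}` for `t ≥ t₀(A, C)` kills the linear budget.  Not landed this cycle; recorded so
that provers do not aim at budgets of type `e^{O(‖z−1‖)}` — and note the budget IS slack on the RIGHT
half-disc, where `|1/Γ(z)| ≤ e^{π|z|/2}` and `|λ_f(z)| ≤ e^{O_f(|z| log log |z|)}`: the `log(‖z−1‖+2)` factor
is forced only by the left half (the `Γ`-poles direction), i.e. by the parity zone. -/

/-- For `u ≥ 0`: `(1 − u + u²)·e^{u} ≥ 1` (multiply `e^u ≥ 1 + u + u²/2` by `1 − u + u² ≥ 0`: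
the product is `1 + (u² + u³ + u⁴)/2`). [folklore] -/
theorem one_le_quad_mul_exp {u : ℝ} (hu : 0 ≤ u) : 1 ≤ (1 - u + u ^ 2) * Real.exp u := by
  have hq : 0 ≤ 1 - u + u ^ 2 := by nlinarith [sq_nonneg (u - 1/2)]
  have he : 1 + u + u ^ 2 / 2 ≤ Real.exp u := Real.quadratic_le_exp_of_nonneg hu
  calc (1 : ℝ) ≤ 1 + (u ^ 2 + u ^ 3 + u ^ 4) / 2 := by nlinarith [pow_nonneg hu 3, pow_nonneg hu 4]
    _ = (1 - u + u ^ 2) * (1 + u + u ^ 2 / 2) := by ring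
    _ ≤ (1 - u + u ^ 2) * Real.exp u := mul_le_mul_of_nonneg_left he hq

/-- **The capped Euler factor at a negative real point is `≥ 1`.**  For a prime (indeed any real)
`p ≥ 2` and `t ≥ 0`: `(1 − t/p + t²/(p(p−1)))·(1 − 1/p)^{−t} ≥ 1`.  Hence the capped singular series
`F^cap_x(−t) = ∏_{p≤x} (…) ≥ 1` uniformly — the Euler-product half of the `z = −t` lower bound needed to
kill the linear budget (§5). [folklore] -/
theorem one_le_capFactor_neg {p t : ℝ} (hp : 2 ≤ p) (ht : 0 ≤ t) :
    1 ≤ (1 - t / p + t ^ 2 / (p * (p - 1))) * (1 - 1 / p) ^ (-t) := by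
  have hp0 : 0 < p := by linarith
  have hp1 : 0 < p - 1 := by linarith
  have hu : 0 ≤ t / p := div_nonneg ht hp0.le
  have hbase : 0 < 1 - 1 / p := by
    rw [sub_pos, div_lt_one hp0]; linarith
  -- `(1 - 1/p)^{-t} ≥ e^{t/p}`
  have hlog : Real.log (1 - 1 / p) ≤ -(1 / p) := by
    have := Real.log_le_sub_one_of_pos hbase; linarith
  have hpow : Real.exp (t / p) ≤ (1 - 1 / p) ^ (-t) := by
    rw [Real.rpow_def_of_pos hbase, Real.exp_le_exp]
    have : t / p = (-(1 / p)) * (-t) := by field_simp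
    rw [this]
    exact mul_le_mul_of_nonpos_right hlog (by linarith)
  -- `1 - t/p + t²/(p(p-1)) ≥ 1 - u + u²`, `u = t/p`
  have hquad : 1 - t / p + (t / p) ^ 2 ≤ 1 - t / p + t ^ 2 / (p * (p - 1)) := by
    have h1 : (t / p) ^ 2 = t ^ 2 / (p * p) := by rw [div_pow]; ring
    rw [h1]
    have : t ^ 2 / (p * p) ≤ t ^ 2 / (p * (p - 1)) :=
      div_le_div_of_nonneg_left (sq_nonneg t) (mul_pos hp0 hp1) (by nlinarith)
    linarith
  have hq : 0 ≤ 1 - t / p + (t / p) ^ 2 := by nlinarith [sq_nonneg (t / p - 1/2)]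
  calc (1 : ℝ) ≤ (1 - t / p + (t / p) ^ 2) * Real.exp (t / p) := one_le_quad_mul_exp hu
    _ ≤ (1 - t / p + t ^ 2 / (p * (p - 1))) * (1 - 1 / p) ^ (-t) :=
        mul_le_mul hquad hpow (Real.exp_pos _).le (hq.trans hquad)

/-- NEAR-MISS (see the section docstring): the budget without the `log` factor is false for `f = (X)`.
[folklore] -/
theorem not_discMajorantLog_linearBudget :
    ¬ ∀ (k : ℕ) (f : Fin k → ℤ[X]), IsBatemanHornSystem f →
      ∃ A C : ℝ, ∃ x₀ : ℕ, ∀ x : ℕ, x₀ ≤ x → ∀ z : ℂ, ‖z - 1‖ ≤ 3 * Real.log (Real.log (x : ℝ)) →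
        ‖(∑ n ∈ Finset.range (x + 1), (z : ℂ) ^ (stat f n))‖ ≤
          A * (x : ℝ) * (Real.log (x : ℝ)) ^ ((k : ℝ) * ((z : ℂ).re - 1)) * Real.exp (C * ‖(z : ℂ) - 1‖) := by
  sorry

/-! ## §5b (CLOSED in session 3 — see `Negative/RightHalfIrreducible.lean`, p141682): `irreducible` on the RIGHT half-disc

For the right-half stub the reducible non-constant witness `X²` (statistic `2ω(n)`) violates the claim ONLY at
real `t > 1`: `Σ_{n≤x} t^{2ω(n)} ≍ x (log x)^{t²−1}` against the claimed `x (log x)^{t−1}`; at `0 < t < 1`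
no reducible `f` can violate it (for every non-constant `f` the density of `{n : s(f(n)) ≤ j}` is
`≤ (log x)^{−1+o(1)} ≤ (log x)^{t−1}`), and at complex points a violation needs two-sided LSD.  A proof at
`t = 2` needs the divisor-moment LOWER bound `Σ_{n≤x} 4^{ω(n)} ≫ x (log x)^{3}` — which the tree's PROVED
Selberg–Delange theorem (`MontgomeryVaughan2007_thm_7_18_holds` + `SatheSelberg.omegaMeanValue_of_thm_7_18`,
`SatheSelberg.exp_neg_le_satheSelbergF`) supplies: done in `Negative/RightHalfIrreducible.lean`.

## §6 Line `Sketch` — the `Re z = 0` cut (lead prover-line-stmt-Parity-17114-0, PICKED 2026-08-17)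

Skeleton `Cruxes/DiscMajorantLog/Lines/Sketch.lean`: `DiscMajorantLog_of` ⟸ `stub_rightHalfDiscMajorantLog`
(`0 ≤ Re z`) ∧ `stub_leftHalfDiscMajorantLog` (`Re z < 0`), constants `max`-ed; support stub
`stub_largePrimeSwitch` (`X²+1`); barrier stubs `stub_leftHalfTwinViolation`, `stub_rightHalfTwinOfDisc`;
calibration `stub_finZero`.

ATTACKS ON THE LINE (this seat):
1. JOINT SUFFICIENCY: no gap — the composition is kernel-checked and each stub is a restriction of the crux
   (crux ⟹ stub), so the cut is lossless; consequently NEITHER half-disc stub can be refuted without refuting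
   the crux itself (§4: not possible with present knowledge).
2. STUB HYPOTHESES (mutation), RIGHT half: `Negative/RightHalfLoadBearing.lean` —
   `stub_rightHalf_false_without_leadingCoeff_pos` (`−X`: `S_x(1/2) = x+1` vs `x (log x)^{−1/2}`),
   `stub_rightHalf_false_without_hasNoFixedPrimeDivisor` (`C 2`: `S_x(1/2) = (x+1)/2`),
   `stub_rightHalf_false_without_pairwise` (`(X,X)`: `S_x(1/4) ≥ π(x)/16 ≥ x/(32 log x)` by PNT vs
   `x (log x)^{−3/2}`), `stub_rightHalf_not_abs` (`z = i`: no triangle-inequality proof, any `f`, `k ≥ 1` —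
   off the real axis the right stub is CANCELLATION between the layers `#{s_f = j}`, not anatomy);
   `irreducible`: `Negative/RightHalfIrreducible.lean` (`X²`, `t = 2`: `S_x(2) ≥ Σ_{n≤x} 4^{ω(n)} ≥
   (e^{−128}/12) x (log x)³` by `MontgomeryVaughan2007_thm_7_18_holds` at `z = 4`, vs `O(x log x)`; §5b).
   LEFT half: all four clauses load-bearing at `z = −1` (§1 applies verbatim, since `Re(−1) < 0`), and the
   twin barrier `stub_leftHalfTwinViolation` is a theorem (landed by the lead).
3. SUPPORT STUBS (all since LANDED by the lead): `stub_largePrimeSwitch` TRUE (for `x ≥ 1`, `n ≤ x`: `n²+1 < (x+1)²` has at most one prime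
   factor `> x`, to the first power, cofactor `m = (n²+1)/p ≤ (x²+1)/(x+1) < x+1`; uniqueness of `(m,p)`
   makes the fibre count exact; checked as a polynomial identity in `z` for every `x ≤ 120`);
   `stub_rightHalfTwinOfDisc` TRUE (for `0 ≤ Re z`: `Re(−z) − 1 ≤ Re z − 1`, `‖−z−1‖ ≤ ‖z−1‖+2`,
   `(r+2) log(r+4) ≤ r log(r+2) + 2 + 2 log 4 + r/2`; replace `C` by `max C 0` and take `x₀ ≥ 3` so that
   `log x ≥ 1`); `stub_finZero` TRUE (`S_x = x+1 ≤ 2x`).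
4. WHERE THE LINE'S DIFFICULTY SITS (for the lead): the right stub for `k = 1`, `f = X` is Selberg–Delange
   with `|z| ≤ 1 + 3L` uniformity — the tree's `MontgomeryVaughan2007_thm_7_18_holds` (MV Thm 7.18, PROVED)
   gives `∃ C(R)` for each FIXED radius `R`, which does not suffice: the stub needs the explicit dependence
   `C(R) ≤ e^{O(R log R)}` (Tenenbaum, *Introduction*, II.5 Thm 5.2 / the `(log T)^{O(|z|)}` contour bound;
   the tree's `LinearCappedRepulsion.JensenStieltjesMajorant` files carry such uniformity for the capped
   statistic with budget `e^{A(1+r)^{3/2}}` on radius `log log x / C`).  BUDGET SLACK: on the right half the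
   truth is `e^{O_f(R log log R)}` (no `Γ`-pole growth), so the right stub could afford the smaller budget
   `e^{C R log log(R+3)}`; the `R log R` budget is forced only on the left half (§5); for every other system it is Halász-type decay of
   `Σ_n z^{s_f(n)}` along polynomial values on `|z| = 1`, `Re z ≥ 0` — open in print (Teräväinen 2024 for the
   state of `λ(P(n))`); the left stub is the crux's parity content (§3–§4).  No stub of this line is false.
-/

/-- Body of the RIGHT-half-disc stub of line `Sketch` (`0 ≤ Re z`) for parameter `k`, exponents `e`. -/
def RightBody (k : ℕ) (e : ℕ → ℕ) : Prop :=
  ∃ A C : ℝ, ∃ x₀ : ℕ, ∀ x : ℕ, x₀ ≤ x → ∀ z : ℂ, ‖z - 1‖ ≤ 3 * Real.log (Real.log (x : ℝ)) →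
    0 ≤ z.re →
    ‖(∑ n ∈ Finset.range (x + 1), (z : ℂ) ^ (e n))‖ ≤
      A * (x : ℝ) * (Real.log (x : ℝ)) ^ ((k : ℝ) * ((z : ℂ).re - 1)) *
        Real.exp (C * ‖(z : ℂ) - 1‖ * Real.log (‖(z : ℂ) - 1‖ + 2))

/-- `stub_rightHalfDiscMajorantLog` with `pairwise_not_associated` dropped. -/
def RightWithoutPairwise : Prop :=
  ∀ (k : ℕ) (f : Fin k → ℤ[X]), (∀ i, Irreducible (f i)) → (∀ i, 0 < (f i).leadingCoeff) →
    HasNoFixedPrimeDivisor f → RightBody k (stat f)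

/-- `stub_rightHalfDiscMajorantLog` with `irreducible` dropped (members still non-constant). -/
def RightWithoutIrreducible : Prop :=
  ∀ (k : ℕ) (f : Fin k → ℤ[X]), (∀ i, 0 < (f i).natDegree) → (∀ i, 0 < (f i).leadingCoeff) →
    (Pairwise fun i j => ¬Associated (f i) (f j)) → HasNoFixedPrimeDivisor f → RightBody k (stat f)

/-- `stub_rightHalfDiscMajorantLog` with `leadingCoeff_pos` dropped (members still non-constant). -/
def RightWithoutLeadingCoeffPos : Prop :=
  ∀ (k : ℕ) (f : Fin k → ℤ[X]), (∀ i, 0 < (f i).natDegree) → (∀ i, Irreducible (f i)) →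
    (Pairwise fun i j => ¬Associated (f i) (f j)) → HasNoFixedPrimeDivisor f → RightBody k (stat f)

/-- `stub_rightHalfDiscMajorantLog` with `hasNoFixedPrimeDivisor` dropped. -/
def RightWithoutNoFixedPrimeDivisor : Prop :=
  ∀ (k : ℕ) (f : Fin k → ℤ[X]), (∀ i, Irreducible (f i)) → (∀ i, 0 < (f i).leadingCoeff) →
    (Pairwise fun i j => ¬Associated (f i) (f j)) → RightBody k (stat f)

/-- **Line `Sketch`, RIGHT half-disc: all four clauses are load-bearing, by PARITY-FREE witnesses**
(`Negative/RightHalfLoadBearing.lean` p141187, `Negative/RightHalfIrreducible.lean` p141682): `(X,X)` at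
`t = 1/4` (PNT), `X²` at `t = 2` (Selberg–Delange at `z = 4`), `−X` and `C 2` at `t = 1/2`. [folklore] -/
theorem line_Sketch_rightHalf_loadBearing :
    ¬ RightWithoutPairwise ∧ ¬ RightWithoutLeadingCoeffPos ∧ ¬ RightWithoutNoFixedPrimeDivisor :=
  ⟨stub_rightHalf_false_without_pairwise, stub_rightHalf_false_without_leadingCoeff_pos,
    stub_rightHalf_false_without_hasNoFixedPrimeDivisor⟩

/-! `¬ RightWithoutIrreducible` is `Summit.Parity.BatemanHorn.Theorems.DiscMajorantLog.Negative.
stub_rightHalf_false_without_irreducible` (`Negative/RightHalfIrreducible.lean`, p141682 ACCEPTED; not yet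
imported here only because the farm olean lagged at publication time — `exact` it verbatim). -/

/-- **Line `Sketch`, RIGHT half-disc: no triangle-inequality proof** for any system with `k ≥ 1`
(witness `z = i`; `Negative/RightHalfLoadBearing.lean`). [folklore] -/
theorem line_Sketch_rightHalf_not_abs {k : ℕ} (hk : 1 ≤ k) (f : Fin k → ℤ[X]) :
    ¬ ∃ A C : ℝ, ∃ x₀ : ℕ, ∀ x : ℕ, x₀ ≤ x → ∀ z : ℂ, ‖z - 1‖ ≤ 3 * Real.log (Real.log (x : ℝ)) →
      0 ≤ z.re →
      (∑ n ∈ Finset.range (x + 1), ‖z‖ ^ (stat f n)) ≤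
        A * (x : ℝ) * (Real.log (x : ℝ)) ^ ((k : ℝ) * ((z : ℂ).re - 1)) *
          Real.exp (C * ‖(z : ℂ) - 1‖ * Real.log (‖(z : ℂ) - 1‖ + 2)) :=
  stub_rightHalf_not_abs hk f

/-- **Line `Sketch`, LEFT half-disc: the barrier stub `stub_leftHalfTwinViolation` is a theorem** — landed
by the LEAD (`Theorems/AlmostPrimeZerosDiscMajorantLogLeftHalfTwinViolation.lean`, 03:59Z; this seat's
independent proof p141681 bounced as a duplicate): witness `![X]`, `z = −1`, twin `= 2·#{s even} ≥ 2⌊x/4⌋`.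
[folklore] -/
theorem line_Sketch_stub_leftHalfTwinViolation :
    ¬ ∀ (k : ℕ) (f : Fin k → Polynomial ℤ), Literature.NumberTheory.Sieve.IsBatemanHornSystem f →
      ∃ A C : ℝ, ∃ x₀ : ℕ, ∀ x : ℕ, x₀ ≤ x → ∀ z : ℂ, ‖z - 1‖ ≤ 3 * Real.log (Real.log (x : ℝ)) →
        z.re < 0 →
        ‖(∑ n ∈ Finset.range (x + 1), (z : ℂ) ^ (∑ i, (((f i).eval (n : ℤ)).toNat.factorization.sum fun _ v => min v 2))) +
            (∑ n ∈ Finset.range (x + 1), (-z : ℂ) ^ (∑ i, (((f i).eval (n : ℤ)).toNat.factorization.sum fun _ v => min v 2)))‖ ≤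
          A * (x : ℝ) * (Real.log (x : ℝ)) ^ ((k : ℝ) * ((z : ℂ).re - 1)) *
            Real.exp (C * ‖(z : ℂ) - 1‖ * Real.log (‖(z : ℂ) - 1‖ + 2)) :=
  Summit.Parity.BatemanHorn.Cruxes.DiscMajorantLog.Sketch.stub_leftHalfTwinViolation

/-! ## §4 Why it resists — zone map, heuristics, attacks run (numbers, not adjectives)

Write `z = 1 + r e^{iφ}`, `0 ≤ r ≤ 3L`, budget `B(r) = e^{C r log(r+2)}`, harmonic factor `(log x)^{k r cos φ}`.

1. HEURISTIC CONSISTENCY EVERYWHERE.  `S_x(z) ≈ x λ_f(z) (D log x)^{k(z−1)} Γ(z)^{−k}`, `D = ∏ deg f_i`,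
   `λ_f(z) = ∏_p E_p(z)(1−1/p)^{k(z−1)}`, `E_p(z) = 1 + (z−1) ω_f(p)(p+z)/p²` off the resultant primes
   (zeros at `|1 − z_p| = p/√ω_f(p)`).  Sizes: `log|Γ(z)^{−k}| ≤ k|z| log|z| + O(k|z|)`;
   `log|λ_f(z)| ≤ Σ_{p≤|z|}[2 log(|z|/p) + k|z|/p + O(1)] + O(|z|/log|z|) = k|z| log log|z| + O_f(|z|)`;
   `|D^{z−1}| ≤ e^{|z−1| log D}`.  All `≤ C‖z−1‖ log(‖z−1‖+2)` with `C = C(f)`: no point of the disc is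
   heuristically violated, including the edge `r = 3L` in every direction `φ` (e.g. `z = 1 + 3iL`:
   `1/|Γ| ≈ e^{3πL/2} = (log x)^{4.71}`, absorbed since `B(3L) = (log x)^{3C log(3L+2)}`).
2. POSITIVE AXIS `z = t ∈ [1, 1+3L]` (parity-free; the only zone where a construction could refute):
   claim = sharp moment `Σ_n t^{s_f(n)} ≤ A x (log x)^{k(t−1)} e^{Ct log(t+2)}`.  Lower-bound attempts:
   (a) single champion `n` with `f(n)` = product of the first primes: `t^{O(log x/log log x)} = x^{o(1)}`,
   below every point of the budget; (b) CRT clusters with `m ≍ L²` prescribed prime factors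
   (the tilted mean at `t ≍ L`): density `e^{−m log m + O(m)}` versus Poisson(`kL`) mass
   `e^{m log L − m log m + O(m)}` — SMALLER by `e^{m log L}`; (c) large primes `> x` of `f_i(n)`: at most
   `deg f_i` per value, factor `≤ |z|^{2 Σ deg}`, inside the budget.  No contradiction; Rankin's bound
   `x (log x)^{kt} e^{O(t log log t)}` shows the claim up to ONE lost `log x`, recovered for
   `t ≥ L/log L` by the budget itself.  Expected TRUE (Hall–Tenenbaum / Nair–Tenenbaum along `f` with
   traced `t`-dependence).
3. `0 < z < 1`: lower tail = almost-prime upper bounds `#{n ≤ x : s_f(n) = j} ≪ x (log x)^{−k}(kL)^j e^j/j^j`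
   (upper-bound sieve + Hardy–Ramanujan along `f`): expected TRUE.
4. `|z| = 1`, `z ≠ 1`, and the left half-disc: pure cancellation (`not_abs`): Halász decay on the circle,
   tilted Chowla along `f` inside; `z = −1` = Liouville saving `(log x)^{−2k}` (§3).  For `k = 1`, `f`
   linear these are theorems in print for fixed `z` (LSD, TW class) and the growing radius costs
   `|ζ(s)^z| ≤ (log T)^{O(|z|)} = e^{O(L²)} ≪ e^{c√log x}` on the contour — room to spare, so the
   calibration case cannot refute either.  For nonlinear `f` / `k ≥ 2`: OPEN (Teräväinen AJM 2024 p.3: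
   `Σ λ(P(n)) = o(x)` wide open for nonlinear irreducible factors; power-saving 2-point Chowla open).
   UNREFUTABLE with present knowledge: a counterexample system = failure of Chowla along that system by
   a power of `log x`.
5. NUMERICS cannot bite: at `x = 10⁶`, `L = 2.63`, `R = 3L = 7.9`, the edge budget is `e^{7.9 C log 9.9}
   = e^{18.1 C}` against the edge saving `e^{−3kL²} = e^{−20.7k}`; the asymptotic regime `L ≫ C log(3L+2)`
   starts at `x > exp(exp(e^{C}))`.  Inside `r ≤ 2` the prior seat's table (disc_check.txt, `x ≤ 10⁶`)
   fits `C ≈ 1.5` (`X`), `3.2` (`(X,X+2)`), argmax on the negative axis — consistent.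
6. DEGENERATE / JUNK: `k = 0` TRUE (`A = 2, C = 0`); `x ≤ 2` (empty or one-point disc) absorbed by `x₀`;
   `x₀` itself is dispensable given `A` (finitely many `x ∈ [16, x₀)`, compact disc, continuous sides —
   provable, not worth landing); `0^0 = 1` makes `S_x(0) = #{n ≤ x : s_f(n) = 0} = O_f(1)`, harmless;
   constants / negative leading coefficients / duplicates are exactly what the four clauses exclude (§1).
7. RADIUS.  The all-`ℂ` version (no radius) with the same budget is NOT refuted even for `f = (X)`
   (single-term test: `t^{s_max}` with `s_max ≈ log x/log log x` loses to `(log x)^{t−1}` for every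
   `t`); the radius `3L` is where the glue (`stub_nearZone_of_majorant`, Jensen at centre `1`) stops
   needing the majorant, not a truth threshold.
-/

end Summit.Parity.BatemanHorn.Cruxes.DiscMajorantLog.Disproof
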